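import Literature.MathematicalPhysics.QuantumFieldTheory.Balaban1983to89.B8Prop7TowerAxialIneq145
import Literature.MathematicalPhysics.QuantumFieldTheory.Balaban1983to89.B8Prop7GlevZd3P

/-!
# `Balaban1983to89.B8Prop7TowerAxialCollarP` — [Balaban1985RegularSpaces] **Proposition 7** (1.145) p. 100 FOR PRINT'S TOWER-WISE AXIAL MAP ON THE P-CARRIER
# `B8LeafModelZd3P.zdGF3P`: THE COLLAR LEMMA — (1.145) at the `j`-bonds of print's p. 77 ONE-END-POINT class (one end-block in `Ω_j^{(j)}`, the other possibly in the
# (1.4) collar `Ω_{j−1} ∖ Ω_j`), read from (1.33) ∕ (1.140) ONE LEVEL DOWN on the bond box, windows at `(L²α₀, L²α₂)`; hence the REPAIRED Proposition 7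
# `B8Ineq145.Prop7RepairedC (530·d·L²)` on the P-carrier at EVERY nested `Ω₀ = ℤᵈ` law member, modulo the displayed collar law (print (1.4)) — the sequel of
# n05-c g6's `B8Prop7TowerAxialIneq145.prop7RepairedC_zdGF3_toAxialTower` (box form, p518422) that the one-end-point letter of the P-carrier needs

statement-level skeleton of published theorems with citation tags; proofs where landed; nothing here is a claim about the Yang–Mills mass gap

T. Bałaban, *Spaces of regular gauge field configurations on a lattice and gauge fixing conditions*, Commun. Math. Phys. **99** (1985) 75–102
`[Balaban1985RegularSpaces]` ("B8"): Prop. 7 (1.144)–(1.145) p. 100 («on Ω_j^{(j)}»), (1.139)–(1.141) p. 100, (1.35) p. 82, (1.4)–(1.5) p. 77 («dist(Ω_{j+1}^c, Ω_j) > RM₁Lʲη»), p. 77 (bond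
convention); [3] = `[Balaban1985Averaging]` (52)–(53) p. 26, (69)–(71) p. 29, (161)–(163) p. 42, p. 24 (locality).  PDF held: `paper:balaban1985-cmp99-regular-spaces-gauge-fixing`.

## WHY THIS FILE (cell `pub-ymgap`, HUMAN RULING D-0062 ∕ D-0149; width seat `pub-ymgap-dag-n05-w1` g0, DAG node N05 = [B8]; count-neutral)

The P-carrier (`B8LeafModelZd3P`, p588746) reads Proposition 7's conclusion (1.145) `avgClose` in print's ONE-END-POINT class.  n05-c g6's honest tower-wise Prop 7 on the old
carrier (`prop7RepairedC_zdGF3_toAxialTower`, p518422) proves (1.145) bond by bond under the BOX guard «`Bʲ(z) ∪ Bʲ(z+e_μ) ⊂ Ω_j`» (`bond_facts … hbox`: the clamped standing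
`clampedStanding` reads (1.33) ∕ (1.140) at level `j` on the box), so it does not transfer to the P-letter at nested members (this seat's `B8Prop7GlevZd3P` header, LOCATED).
THIS FILE supplies the missing bonds: for a `j`-bond with one end-block in `Ω_j^{(j)}`, print's (1.4) separation puts the whole two-block box in `Ω_{j−1}` (the displayed
collar law `hcollar`; NODE 00's `ZdIdx` carries no such law), where (1.33) ∕ (1.140) hold AT LEVEL `j − 1`: `clampedStanding` at depth `j − 1` on the box, its outputs
re-expressed at depth `j` with the constants `(α₀, α₂) ↦ (L²α₀, L²α₂)` (`(Lʲ⁻¹)⁻¹ ≤ L·(Lʲ)⁻¹`) — the same one-level-down move as dag-n05-e's edition-γ Theorem-4 driver — and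
then r05 g7's standing theorems at depth `j` VERBATIM (`avgIter_mem_unitaryUnits`, `avgIter_mul_mem_unitaryUnits`, `norm_tildIter_sub_one_le`, windows `windows_of_cst` at the
scaled pair, thresholds `L²α₀, L²α₂ ≤ cst d L`).

## WHAT IS PROVED (kernel, 0 sorry; theorems only)

* §1 `bond_facts_collar` — n05-c's `bond_facts` at a bond whose box lies in `Ω_{j−1}`: `Ū₀ʲ_b`, `Ũʲ_b` unitary and `‖Ũʲ_b − 1‖ ≤ 130d·(L²α₂)`.
* §2 ★★ `avgClose_toAxialTower_oneEnd` — (1.145) IN THE P-CARRIER'S ONE-END-POINT LETTER for `toAxialTower`, constant `530·d·L²`, under `hcollar`.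
* §3 ★★ `prop7RepairedC_zdGF3P_toAxialTower` ∕ `prop7RepairedC_zdGF3HP_toAxialTower` — `B8Ineq145.Prop7RepairedC (530·d·L²) (zdGF3P ∘ e) (toAxialTower ∘ e)` over any index map
  into `Ω₀ = ℤᵈ` members with NODE 00's truncation laws (`hlt`, `htop`) and the collar law; threshold `cst d L ∕ L²`.

## HONEST SCOPE

A re-run of ONE landed estimate one level down + by-name assembly; nothing of [Balaban1985RegularSpaces] or [3] is proved anew; the constant `530·d·L²` and the threshold
`cst(d,L)∕L²` are the tree's crude witnesses (print: `2α₂`, «α₀, α₂ sufficiently small»); the collar law `hcollar` (print's (1.4)) is a DISPLAYED HYPOTHESIS, not a law of the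
index; the (1.144) conjunct is n05-c's `inAAx_toAxialTower_of_laws` verbatim (fields `rfl`-equal).  Count-neutral; N05 NOT discharged; no count claim; one finite `𝕋⁴` programme
at fixed `ε`, Bałaban AS PRINTED; the Yang–Mills mass gap (Clay) is NOT proved by any of this — R4 closes the conditional finite-`𝕋⁴` rung `BalabanLadder.UV` only; nothing
continuum ∕ ℝ⁴ ∕ OS.  No `sorry`, no `def`, no `instance`, no `notation`.  Unit `pub-ymgap-dag-n05-w1` (g0), 2026-08-28.

[cite: Balaban1985RegularSpaces, Prop. 7 (1.144)–(1.145) p.100, (1.139)–(1.141) p.100, (1.35) p.82, (1.4)–(1.5) p.77, p.77; Balaban1985Averaging, (52)–(53) p.26, (69)–(71) p.29,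
(161)–(163) p.42, p.24]
-/

noncomputable section

open NormedSpace

namespace Literature.MathematicalPhysics.QuantumFieldTheory.Balaban1983to89.B8Prop7TowerAxialCollarP

open B7Prop1Explicit B7Prop2Explicit B7Prop1Local B7Eq92Concrete B7Eq84Concrete
open B7Prop2Explicit (C0 c2' unitaryUnits_le_U1)
open B7Prop3Flat (c3)
open B8Ineq132 (InAk)
open B8Eq146AExpansion (iEta expCfg)
open B8Lemma1NonAbelian (mulCfg)
open B8Thm4Concrete (mulCfg_eq_mul)
open B8Prop7AdmittedFamily (cst cst_pos norm_tildIter_sub_one_le avgIter_mem_unitaryUnits avgIter_mul_mem_unitaryUnits)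
open B7Prop8PrintedConstants (Rc_mem_unitaryUnits)
open B7AvgGaugeCovariance (uLev)
open B8Prop7TowerAxialUnitary (clampedStanding uTower_facts inAAx_toAxialTower_of_laws clampFld agreeOn_mul windows_of_cst)
open B8Prop7TowerAxialZd3 (uTower toAxialTower)
open B8Prop7TowerAxialIneq145 (bond_facts)
open B8LeafModelZd (ZdIdx)
open B8LeafModelZd3 (zdGF3 mlogCfg)
open B8LeafModelZd3P (zdGF3P zdGF3HP EndBlockIn)

-- `Site` alone could resolve to the torus sites of `Setup.lean`; re-export the `ℤ^d` sites of `B7Prop1Explicit`.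
export B7Prop1Explicit (Site)

variable {d : ℕ}

section Arith

variable {𝔸 : Type} [CStarAlgebra 𝔸] [Nontrivial 𝔸] {L : ℕ}

/-- `|abc − 1| ≤ |a − 1| + |b − 1| + |c − 1|` for `a, b ∈ {|u| ≤ 1, |u⁻¹| ≤ 1}` (private arithmetic, as in n05-c's file). [folklore] -/
private theorem norm_mul₃_units_sub_one_le {a b c : 𝔸ˣ} (ha : a ∈ U1 𝔸) (hb' : b ∈ U1 𝔸) :
    ‖((a * b * c : 𝔸ˣ) : 𝔸) - 1‖ ≤ ‖(a : 𝔸) - 1‖ + ‖(b : 𝔸) - 1‖ + ‖(c : 𝔸) - 1‖ :=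
  (B8Lemma1NonAbelian.norm_units_mul_sub_one_le ((U1 𝔸).mul_mem ha hb')).trans
    (by linarith [B8Lemma1NonAbelian.norm_units_mul_sub_one_le (q := b) ha])

/-- The bond box is a genuine box (`L ≥ 1`; private plumbing). [folklore] -/
private theorem loK_le_bondHiK (hL1 : 1 ≤ L) (j : ℕ) (z : Site d) (μ : Fin d) : ∀ i', loK L j z i' ≤ bondHiK L j z μ i' := by
  intro i'
  have h1 : (1 : ℤ) ≤ (L : ℤ) ^ j := by exact_mod_cast Nat.one_le_pow j L hL1
  simp only [loK, bondHiK]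
  split_ifs <;> linarith

/-- One level down costs a factor `L`: `(Lʲ⁻¹)⁻¹ ≤ L·(Lʲ)⁻¹` (`ℕ` subtraction: equality for `j ≥ 1`, `1 ≤ L` at `j = 0`). [folklore] -/
private theorem inv_pow_pred_le {L : ℕ} (hL1 : 1 ≤ L) (j : ℕ) : ((L : ℝ) ^ (j - 1))⁻¹ ≤ (L : ℝ) * ((L : ℝ) ^ j)⁻¹ := by
  have hLr : (1 : ℝ) ≤ L := by exact_mod_cast hL1
  have hLpos : (0 : ℝ) < L := by linarith
  rcases Nat.eq_zero_or_pos j with rfl | hjp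
  · simp only [Nat.zero_sub, pow_zero, inv_one, mul_one]; exact hLr
  · obtain ⟨n, rfl⟩ : ∃ n, j = n + 1 := ⟨j - 1, by omega⟩
    rw [Nat.add_sub_cancel, pow_succ, mul_inv, ← mul_assoc, mul_comm (L : ℝ), mul_assoc, mul_inv_cancel₀ hLpos.ne', mul_one]

end Arith

/-! ## §1 The averaged product and background at a COLLAR bond, localised one level down -/

section Collar

variable {𝔸 : Type} [CStarAlgebra 𝔸] [Nontrivial 𝔸] {L : ℕ} {β : ℝ} {len : Site d → ℝ}
set_option maxHeartbeats 400000 in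
/-- **n05-c's `bond_facts` AT A BOND WHOSE BOX LIES IN `Ω_{j−1}`** (`j ≤ k`; thresholds `L²α₀, L²α₂ ≤ c(d, L)`): `Ū₀ʲ_b` and `Ũʲ_b` are unitary-valued and
`|Ũʲ_b − 1| ≤ 130d·(L²α₂)` — the clamped standing `clampedStanding` read at depth `j − 1` on the bond box (where (1.33) ∕ (1.140) are available), its plaquette and field
bounds re-expressed at depth `j` with `(α₀, α₂) ↦ (L²α₀, L²α₂)`, then r05 g7's standing theorems at depth `j` verbatim.
[cite: Balaban1985RegularSpaces, (1.139)–(1.141) p.100, (1.4) p.77; Balaban1985Averaging, (52)–(53) p.26, (161)–(163) p.42, p.24] -/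
theorem bond_facts_collar (hd2 : 2 ≤ d) (hL : 2 ≤ L) (i : ZdIdx d L) (hΩ0 : i.Ω 0 = Set.univ)
    {α₀ α₂ : ℝ} (hα₀ : 0 < α₀) (hα₀c : (L : ℝ) ^ 2 * α₀ ≤ cst d L) (hα₂ : 0 < α₂) (hα₂c : (L : ℝ) ^ 2 * α₂ ≤ cst d L)
    (U₀ : (zdGF3 𝔸 L β len i).Cfg) (P : (zdGF3 𝔸 L β len i).Pert)
    (hInA : (zdGF3 𝔸 L β len i).InA α₀ U₀) (h140 : (zdGF3 𝔸 L β len i).C140 α₂ U₀ P)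
    {j : ℕ} (hj : j ≤ i.k) (z : Site d) (μ : Fin d) (hbox : ∀ x, InBox (loK L j z) (bondHiK L j z μ) x → x ∈ i.Ω (j - 1)) :
    avgIter L U₀.1 j z μ ∈ unitaryUnits 𝔸 ∧ tildIter L U₀.1 P.2.1 j z μ ∈ unitaryUnits 𝔸 ∧
      ‖((tildIter L U₀.1 P.2.1 j z μ : 𝔸ˣ) : 𝔸) - 1‖ ≤ 130 * (d : ℝ) * ((L : ℝ) ^ 2 * α₂) := by
  have hL1 : 1 ≤ L := le_trans one_le_two hL
  have hd : 1 ≤ d := le_trans one_le_two hd2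
  have hLr : (1 : ℝ) ≤ L := by exact_mod_cast hL1
  have hL2 : (1 : ℝ) ≤ (L : ℝ) ^ 2 := one_le_pow₀ hLr
  -- the unscaled thresholds follow from the scaled ones
  have hα₀c' : α₀ ≤ cst d L := le_trans (by nlinarith) hα₀c
  have hα₂c' : α₂ ≤ cst d L := le_trans (by nlinarith) hα₂c
  -- the clamped standing at depth `j − 1` on the bond box
  obtain ⟨hU₀cu, hBcu, -, -, -, h52, -, hBcn, -, -, -, -, -, -, hP, -, h₀, h₁⟩ :=
    clampedStanding hd2 hL i hΩ0 hα₀ hα₀c' hα₂ hα₂c' U₀ P hInA h140 (J := j - 1) ((Nat.sub_le j 1).trans hj) (loK_le_bondHiK hL1 j z μ) hbox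
  -- the windows at the scaled pair, depth `j`
  have hLα₀ : 0 < (L : ℝ) ^ 2 * α₀ := by positivity
  have hLα₂ : 0 < (L : ℝ) ^ 2 * α₂ := by positivity
  obtain ⟨hscale, hb, hα', hα3', hα4', hsmall, hc₃, hsm, hαP, hαP3, hαP2, -, -⟩ :=
    windows_of_cst hd hL1 j i.hη hLα₀ hα₀c hLα₂ hα₂c
  -- one level down costs `L` (resp. `L²`)
  have hfac := inv_pow_pred_le (L := L) hL1 j
  have hfac2 : (((L : ℝ) ^ (j - 1))⁻¹) ^ 2 ≤ (L : ℝ) ^ 2 * (((L : ℝ) ^ j)⁻¹) ^ 2 := by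
    have h0 : (0 : ℝ) ≤ ((L : ℝ) ^ (j - 1))⁻¹ := by positivity
    have h := mul_self_le_mul_self h0 hfac
    nlinarith [h]
  have h52' : pdev (clampCfg (loK L j z) (bondHiK L j z μ) U₀.1) < 2 * ((L : ℝ) ^ 2 * α₀) * (((L : ℝ) ^ j)⁻¹) ^ 2 := by
    refine h52.trans_le ?_
    have := mul_le_mul_of_nonneg_left hfac2 (by positivity : (0 : ℝ) ≤ 2 * α₀)
    nlinarith [this]
  have hP' : pdev (expCfg (clampFld (loK L j z) (bondHiK L j z μ) (iEta i.η (mlogCfg i.k i.η i.Ω P.2.1))) *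
      clampCfg (loK L j z) (bondHiK L j z μ) U₀.1) < 2 * ((L : ℝ) ^ 2 * α₀ + 3 * ((L : ℝ) ^ 2 * α₂)) * (((L : ℝ) ^ j)⁻¹) ^ 2 := by
    refine hP.trans_le ?_
    have := mul_le_mul_of_nonneg_left hfac2 (by positivity : (0 : ℝ) ≤ 2 * (α₀ + 3 * α₂))
    nlinarith [this]
  have hBcn' : ∀ z' κ, ‖clampFld (loK L j z) (bondHiK L j z μ) (iEta i.η (mlogCfg i.k i.η i.Ω P.2.1)) z' κ‖
      ≤ i.η * (((L : ℝ) ^ 2 * α₂) * ((L : ℝ) ^ j * i.η)⁻¹) := by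
    intro z' κ
    refine (hBcn z' κ).trans ?_
    have hη : 0 < i.η := i.hη
    rw [mul_inv, mul_inv]
    have h1 : α₂ * (((L : ℝ) ^ (j - 1))⁻¹ * i.η⁻¹) ≤ α₂ * ((L : ℝ) * ((L : ℝ) ^ j)⁻¹ * i.η⁻¹) :=
      mul_le_mul_of_nonneg_left (mul_le_mul_of_nonneg_right hfac (inv_nonneg.mpr hη.le)) hα₂.le
    have h2 : α₂ * ((L : ℝ) * ((L : ℝ) ^ j)⁻¹ * i.η⁻¹) ≤ (L : ℝ) ^ 2 * α₂ * (((L : ℝ) ^ j)⁻¹ * i.η⁻¹) := by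
      have hx : 0 ≤ α₂ * (((L : ℝ) ^ j)⁻¹ * i.η⁻¹) := by positivity
      have hLL : (L : ℝ) ≤ (L : ℝ) ^ 2 := by nlinarith
      calc α₂ * ((L : ℝ) * ((L : ℝ) ^ j)⁻¹ * i.η⁻¹) = (L : ℝ) * (α₂ * (((L : ℝ) ^ j)⁻¹ * i.η⁻¹)) := by ring
        _ ≤ (L : ℝ) ^ 2 * (α₂ * (((L : ℝ) ^ j)⁻¹ * i.η⁻¹)) := mul_le_mul_of_nonneg_right hLL hx
        _ = (L : ℝ) ^ 2 * α₂ * (((L : ℝ) ^ j)⁻¹ * i.η⁻¹) := by ring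
    exact mul_le_mul_of_nonneg_left (h1.trans h2) hη.le
  -- locality of the `j`-fold averages on the bond box
  have e₀ : avgIter L U₀.1 j z μ = avgIter L (clampCfg (loK L j z) (bondHiK L j z μ) U₀.1) j z μ := avgIter_congr L hL1 j z μ h₀
  have e₁ : avgIter L (P.2.1 * U₀.1) j z μ =
      avgIter L (expCfg (clampFld (loK L j z) (bondHiK L j z μ) (iEta i.η (mlogCfg i.k i.η i.Ω P.2.1))) *
        clampCfg (loK L j z) (bondHiK L j z μ) U₀.1) j z μ :=
    avgIter_congr L hL1 j z μ (agreeOn_mul h₁ h₀)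
  have hV₀ := avgIter_mem_unitaryUnits hL hU₀cu hα' hα3' hα4' h52' j le_rfl z μ
  have hV₁ := avgIter_mul_mem_unitaryUnits hL hU₀cu hBcu hαP hαP3 hαP2 hP' j le_rfl z μ
  have htt : tildIter L U₀.1 P.2.1 j z μ =
      tildIter L (clampCfg (loK L j z) (bondHiK L j z μ) U₀.1)
        (expCfg (clampFld (loK L j z) (bondHiK L j z μ) (iEta i.η (mlogCfg i.k i.η i.Ω P.2.1)))) j z μ := by
    rw [tildIter_apply, tildIter_apply, e₀, e₁]
  refine ⟨?_, ?_, ?_⟩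
  · rw [e₀]; exact hV₀
  · rw [htt, tildIter_apply]
    exact (unitaryUnits 𝔸).mul_mem hV₁ ((unitaryUnits 𝔸).inv_mem hV₀)
  · have h := norm_tildIter_sub_one_le hd hL hU₀cu hBcu hα' hα3' hα4' h52' hb hBcn' hsmall hc₃ hsm hαP hαP3 hαP2 hP' le_rfl z μ
    rw [hscale] at h
    rw [htt]
    exact h

/-! ## §2 (1.145) in the P-carrier's ONE-END-POINT letter for print's tower-wise map -/

/-- ★★ **(1.145) IN THE P-CARRIER'S ONE-END-POINT LETTER FOR PRINT'S TOWER-WISE MAP, constant `530·d·L²`**: at a member with `Ω₀ = ℤᵈ` (`d, L ≥ 2`), for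
`0 < α₀, α₂` with `L²α₀, L²α₂ ≤ c(d, L)` and every datum with (1.139) ∕ (1.140), under the COLLAR LAW «the two-block box of a `j`-bond with an end-block in `Ω_j^{(j)}` lies in
`Ω_{j−1}`» (print (1.4)): `(zdGF3P …).avgClose (530dL²·α₂) U₀ (toAxialTower … U₀ P)`.  n05-c's `avgClose_toAxialTower` proof VERBATIM with `bond_facts_collar` for `bond_facts`
(the two gauge ends are `uTower_facts`' `200d·α₂` each, unscaled). [cite: Balaban1985RegularSpaces, Prop. 7 (1.145) p.100, (1.35) p.82, (1.4) p.77, p.77; Balaban1985Averaging, (69)–(71) p.29, (163) p.42] -/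
theorem avgClose_toAxialTower_oneEnd (hd2 : 2 ≤ d) (hL : 2 ≤ L) (i : ZdIdx d L) (hΩ0 : i.Ω 0 = Set.univ)
    (hcollar : ∀ j, j ≤ i.k → ∀ (z : Site d) (μ : Fin d), EndBlockIn L (i.Ω j) j z μ →
      ∀ x, InBox (loK L j z) (bondHiK L j z μ) x → x ∈ i.Ω (j - 1))
    {α₀ α₂ : ℝ} (hα₀ : 0 < α₀) (hα₀c : (L : ℝ) ^ 2 * α₀ ≤ cst d L) (hα₂ : 0 < α₂) (hα₂c : (L : ℝ) ^ 2 * α₂ ≤ cst d L)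
    (U₀ : (zdGF3P 𝔸 L β len i).Cfg) (P : (zdGF3P 𝔸 L β len i).Pert)
    (hInA : (zdGF3P 𝔸 L β len i).InA α₀ U₀) (h140 : (zdGF3P 𝔸 L β len i).C140 α₂ U₀ P) :
    (zdGF3P 𝔸 L β len i).avgClose (530 * (d : ℝ) * (L : ℝ) ^ 2 * α₂) U₀ (toAxialTower 𝔸 L β len (le_trans one_le_two hL) i U₀ P) := by
  have hL1 : 1 ≤ L := le_trans one_le_two hL
  have hLr : (1 : ℝ) ≤ L := by exact_mod_cast hL1
  have hL2 : (1 : ℝ) ≤ (L : ℝ) ^ 2 := one_le_pow₀ hLr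
  have hα₀c' : α₀ ≤ cst d L := le_trans (by nlinarith) hα₀c
  have hα₂c' : α₂ ≤ cst d L := le_trans (by nlinarith) hα₂c
  have hu := uTower_facts (β := β) (len := len) hd2 hL i hΩ0 hα₀ hα₀c' hα₂ hα₂c' U₀ P hInA h140
  rw [B8Prop7TowerAxialZd3.toAxialTower_of_unitary (β := β) (len := len) hL1 i U₀ P (fun x => (hu x).1)]
  intro j hj z μ hend
  set u := uTower L hL1 i.k (i.Λs i.k) U₀.1 P.2.1 with hu_def
  show ‖((avgIter L (mulCfg (mgauge U₀.1 u P.2.1) U₀.1) j z μ : 𝔸ˣ) : 𝔸) - ((avgIter L U₀.1 j z μ : 𝔸ˣ) : 𝔸)‖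
      ≤ 530 * (d : ℝ) * (L : ℝ) ^ 2 * α₂
  obtain ⟨hV₀, htildU, htild⟩ := bond_facts_collar (β := β) (len := len) hd2 hL i hΩ0 hα₀ hα₀c hα₂ hα₂c U₀ P hInA h140 hj z μ (hcollar j hj z μ hend)
  have hsplit : avgIter L (mulCfg (mgauge U₀.1 u P.2.1) U₀.1) j z μ =
      tildIter L U₀.1 (mgauge U₀.1 u P.2.1) j z μ * avgIter L U₀.1 j z μ := by
    rw [mulCfg_eq_mul, ← tildIter_mul]; rfl
  have hd1 : (1 : ℝ) ≤ d := by exact_mod_cast (le_trans one_le_two hd2 : 1 ≤ d)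
  have hX : ‖((tildIter L U₀.1 (mgauge U₀.1 u P.2.1) j z μ : 𝔸ˣ) : 𝔸) - 1‖ ≤ 530 * (d : ℝ) * (L : ℝ) ^ 2 * α₂ := by
    rw [tildIter_mgauge, mgauge_apply]
    obtain ⟨ha1, han⟩ := hu (((L : ℤ) ^ j) • z)
    obtain ⟨hc1, hcn⟩ := hu (((L : ℤ) ^ j) • (z + e μ))
    have ha : uLev L u j z ∈ U1 𝔸 := unitaryUnits_le_U1 ha1
    have hb' : tildIter L U₀.1 P.2.1 j z μ ∈ U1 𝔸 := unitaryUnits_le_U1 htildU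
    have hR : Rc (avgIter L U₀.1 j z μ) (uLev L u j (z + e μ)) ∈ U1 𝔸 := unitaryUnits_le_U1 (Rc_mem_unitaryUnits hV₀ hc1)
    have h3 : ‖((uLev L u j z * tildIter L U₀.1 P.2.1 j z μ * (Rc (avgIter L U₀.1 j z μ) (uLev L u j (z + e μ)))⁻¹ : 𝔸ˣ) : 𝔸) - 1‖
        ≤ ‖((uLev L u j z : 𝔸ˣ) : 𝔸) - 1‖ + ‖((tildIter L U₀.1 P.2.1 j z μ : 𝔸ˣ) : 𝔸) - 1‖ +
          ‖(((Rc (avgIter L U₀.1 j z μ) (uLev L u j (z + e μ)))⁻¹ : 𝔸ˣ) : 𝔸) - 1‖ :=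
      norm_mul₃_units_sub_one_le ha hb'
    have hcb : ‖(((Rc (avgIter L U₀.1 j z μ) (uLev L u j (z + e μ)))⁻¹ : 𝔸ˣ) : 𝔸) - 1‖ ≤ 200 * (d : ℝ) * α₂ := by
      refine (norm_inv_sub_one_le hR).trans ?_
      rw [Rc_apply, Units.val_mul, Units.val_mul]
      exact (norm_units_conj_sub_one_le (unitaryUnits_le_U1 hV₀) _).trans hcn
    have han' : ‖((uLev L u j z : 𝔸ˣ) : 𝔸) - 1‖ ≤ 200 * (d : ℝ) * α₂ := han
    have hsum : 200 * (d : ℝ) * α₂ + 130 * (d : ℝ) * ((L : ℝ) ^ 2 * α₂) + 200 * (d : ℝ) * α₂ ≤ 530 * (d : ℝ) * (L : ℝ) ^ 2 * α₂ := by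
      nlinarith [mul_nonneg (by positivity : (0 : ℝ) ≤ (d : ℝ) * α₂) (sub_nonneg.2 hL2)]
    linarith [h3, han', htild, hcb, hsum]
  rw [hsplit, Units.val_mul]
  have hY : ‖((avgIter L U₀.1 j z μ : 𝔸ˣ) : 𝔸)‖ ≤ 1 := (unitaryUnits_le_U1 hV₀).1
  have key : ((tildIter L U₀.1 (mgauge U₀.1 u P.2.1) j z μ : 𝔸ˣ) : 𝔸) * ((avgIter L U₀.1 j z μ : 𝔸ˣ) : 𝔸)
        - ((avgIter L U₀.1 j z μ : 𝔸ˣ) : 𝔸)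
      = (((tildIter L U₀.1 (mgauge U₀.1 u P.2.1) j z μ : 𝔸ˣ) : 𝔸) - 1) * ((avgIter L U₀.1 j z μ : 𝔸ˣ) : 𝔸) := by
    noncomm_ring
  rw [key]
  calc _ ≤ ‖((tildIter L U₀.1 (mgauge U₀.1 u P.2.1) j z μ : 𝔸ˣ) : 𝔸) - 1‖ * ‖((avgIter L U₀.1 j z μ : 𝔸ˣ) : 𝔸)‖ := norm_mul_le _ _
    _ ≤ 530 * (d : ℝ) * (L : ℝ) ^ 2 * α₂ * 1 := mul_le_mul hX hY (norm_nonneg _) (by positivity)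
    _ = _ := mul_one _

end Collar

/-! ## §3 PROPOSITION 7 REPAIRED on the P-carrier for print's tower-wise map, at every nested `Ω₀ = ℤᵈ` law member (modulo the collar law) -/

section Prop7

variable (𝔸 : Type) [CStarAlgebra 𝔸] [Nontrivial 𝔸] (L : ℕ) (β : ℝ) (len : Site d → ℝ)

/-- ★★ **PROPOSITION 7 WITH THE REPAIRED CONSTANT `530·d·L²`, FOR PRINT'S TOWER-WISE AXIAL MAP, ON THE P-CARRIER AT EVERY LAW MEMBER** —
`B8Ineq145.Prop7RepairedC (530·d·L²) (zdGF3P ∘ e) (toAxialTower ∘ e)` for ANY index map `e : J → ZdIdx d L` into members with `Ω₀ = ℤᵈ` obeying NODE 00's truncation laws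
(`hlt` ∕ `htop`, as in n05-c's `prop7RepairedC_zdGF3_toAxialTower`) AND the collar law `hcollar` (print (1.4)); threshold `c(d, L)∕L²`: the (1.144) conjunct is n05-c's
`inAAx_toAxialTower_of_laws` (the field `InAAx` of `zdGF3P` is `zdGF3`'s), the (1.145) conjunct — now in the ONE-END-POINT letter — is `avgClose_toAxialTower_oneEnd`.
[cite: Balaban1985RegularSpaces, Prop. 7 (1.144)–(1.145) p.100, (1.139)–(1.141) p.100, (1.29) p.81, (1.35) p.82, (1.4)–(1.5) p.77; Balaban1985Averaging, (67)–(71) p.29, (76)–(77) pp.29–30, (163) p.42] -/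
theorem prop7RepairedC_zdGF3P_toAxialTower (hd2 : 2 ≤ d) (hL : 2 ≤ L) {J : Type} (e : J → ZdIdx d L) (hΩ0 : ∀ a, (e a).Ω 0 = Set.univ)
    (hlt : ∀ a, ∀ m, m < (e a).k → ∀ j, j < m → (e a).Λs m j = (e a).Λs (m + 1) j)
    (htop : ∀ a, ∀ m, m < (e a).k → ∀ x, x ∈ (e a).Λs m m ↔ x ∈ (e a).Λs (m + 1) m ∨ ∃ y ∈ (e a).Λs (m + 1) (m + 1),
      x ∈ Literature.MathematicalPhysics.QuantumLattice.blockSites L y)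
    (hcollar : ∀ a, ∀ j, j ≤ (e a).k → ∀ (z : Site d) (μ : Fin d), EndBlockIn L ((e a).Ω j) j z μ →
      ∀ x, InBox (loK L j z) (bondHiK L j z μ) x → x ∈ (e a).Ω (j - 1)) :
    B8Ineq145.Prop7RepairedC (530 * (d : ℝ) * (L : ℝ) ^ 2) (fun a : J => zdGF3P 𝔸 L β len (e a))
      (fun a => toAxialTower 𝔸 L β len (le_trans one_le_two hL) (e a)) := by
  have hd : 1 ≤ d := le_trans one_le_two hd2
  have hL1 : 1 ≤ L := le_trans one_le_two hL
  have hLr : (1 : ℝ) ≤ L := by exact_mod_cast hL1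
  have hL20 : (0 : ℝ) < (L : ℝ) ^ 2 := by positivity
  have hL2 : (1 : ℝ) ≤ (L : ℝ) ^ 2 := one_le_pow₀ hLr
  refine ⟨cst d L / (L : ℝ) ^ 2, div_pos (cst_pos hd L hL1) hL20, ?_⟩
  intro a α₀ α₂ hα₀ hα₀c hα₂ hα₂c U₀ P hInA h140
  have hα₀s : (L : ℝ) ^ 2 * α₀ ≤ cst d L := by
    have h := mul_le_mul_of_nonneg_left hα₀c hL20.le; rwa [mul_div_cancel₀ _ hL20.ne'] at h
  have hα₂s : (L : ℝ) ^ 2 * α₂ ≤ cst d L := by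
    have h := mul_le_mul_of_nonneg_left hα₂c hL20.le; rwa [mul_div_cancel₀ _ hL20.ne'] at h
  have hα₀c' : α₀ ≤ cst d L := le_trans (by nlinarith) hα₀s
  have hα₂c' : α₂ ≤ cst d L := le_trans (by nlinarith) hα₂s
  refine ⟨inAAx_toAxialTower_of_laws (β := β) (len := len) hd2 hL (e a) (hΩ0 a) (hlt a) (htop a) hα₀ hα₀c' hα₂ hα₂c' U₀ P hInA h140, ?_⟩
  have h := avgClose_toAxialTower_oneEnd (β := β) (len := len) hd2 hL (e a) (hΩ0 a) (hcollar a) hα₀ hα₀s hα₂ hα₂s U₀ P hInA h140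
  simpa only [mul_assoc] using h

/-- The same on the P-carrier with Theorem 8's source space as printed (`zdGF3HP`; its Prop-7 letters are `zdGF3P`'s by `rfl`).
[cite: Balaban1985RegularSpaces, Prop. 7 (1.144)–(1.145) p.100, (1.4) p.77] -/
theorem prop7RepairedC_zdGF3HP_toAxialTower (hd2 : 2 ≤ d) (hL : 2 ≤ L) {J : Type} (e : J → ZdIdx d L) (hΩ0 : ∀ a, (e a).Ω 0 = Set.univ)
    (hlt : ∀ a, ∀ m, m < (e a).k → ∀ j, j < m → (e a).Λs m j = (e a).Λs (m + 1) j)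
    (htop : ∀ a, ∀ m, m < (e a).k → ∀ x, x ∈ (e a).Λs m m ↔ x ∈ (e a).Λs (m + 1) m ∨ ∃ y ∈ (e a).Λs (m + 1) (m + 1),
      x ∈ Literature.MathematicalPhysics.QuantumLattice.blockSites L y)
    (hcollar : ∀ a, ∀ j, j ≤ (e a).k → ∀ (z : Site d) (μ : Fin d), EndBlockIn L ((e a).Ω j) j z μ →
      ∀ x, InBox (loK L j z) (bondHiK L j z μ) x → x ∈ (e a).Ω (j - 1)) :
    B8Ineq145.Prop7RepairedC (530 * (d : ℝ) * (L : ℝ) ^ 2) (fun a : J => zdGF3HP 𝔸 L β len (e a))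
      (fun a => toAxialTower 𝔸 L β len (le_trans one_le_two hL) (e a)) :=
  prop7RepairedC_zdGF3P_toAxialTower 𝔸 L β len hd2 hL e hΩ0 hlt htop hcollar

end Prop7

#print axioms avgClose_toAxialTower_oneEnd
#print axioms prop7RepairedC_zdGF3P_toAxialTower

end Literature.MathematicalPhysics.QuantumFieldTheory.Balaban1983to89.B8Prop7TowerAxialCollarP

end
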